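import Summits.CriticalPhenomena.Ising3D.BlockTaylorGerm
import Summits.CriticalPhenomena.Ising3D.TaylorFunctional
import Literature.MathematicalPhysics.QuantumFieldTheory.ConformalBootstrap3D.BlockUniquenessLimit
import Literature.MathematicalPhysics.QuantumFieldTheory.ConformalBootstrap3D.BlockGenericNonUniqueness
import Literature.MathematicalPhysics.QuantumFieldTheory.ConformalBootstrap3D.MeanFieldDecompositionAB
import Literature.MathematicalPhysics.QuantumFieldTheory.ConformalBootstrap3D.BlockConjugationSymmetry
import Literature.MathematicalPhysics.QuantumFieldTheory.ConformalBootstrap3D.PointFunctionalTail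
import Mathlib.Tactic.Linarith
import Mathlib.Tactic.Positivity
import Mathlib.Tactic.Ring
import HarnessLib

/-!
# Summable Taylor germs for the three block families of the `σ–ε` sum rules
(cell `pub-ising3x`, seat boot-1; gate (g0) of the M3-γ milestone, part 3d)

HONEST FRAMING: lottery ticket; floor = tightest certified 3D Ising CFT bounds; no exact-solution
claim without a proof.

`crossF_germ_majorant` (part 3c) bounds the germ majorant of `crossF s σ g`, for `g` of block shape
`(z z̄)^τ K`, by `C₁ X₁^{2τ} ∑|k| X₁^{m+n} + |σ| C₂ X₂^{2τ} ∑|k| X₂^{m+n}` with constants independent of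
the block. Here this is turned into `HasSummableGerms` (part 2) for the families of an axiom-satisfying
datum `D` at a diagonal point `(x,x)`:
* `hasSummableGerms_of_blockShape` — the generic step (choice of the germs, comparison of majorants);
* `hasSummableGerms_gp` — the `ℤ₂`-even blocks `gp i = hrBlock` (every admissible point, incl. conserved
  currents: `SatisfiesBootstrapAxioms.gp_eq_hrBlock`; non-negative array ⇒ `∑ k X^{m+n} X^{2τ} = gp i (X,X)`),
  weights summable against `gp i (X,X)` — e.g. `λ_{σσ}²` by the A1 clause `HasConvergentWeights`;
* `hasSummableGerms_gpm` — `gpm j = hrBlockAB (-Δ_σε) Δ_σε` (non-negative `(a,a)` array);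
* `hasSummableGerms_gmm` — the SIGNED family `gmm j = hrBlockAB Δ_σε Δ_σε`: coefficient-level domination
  `|k^{(c,-c)}| ≤ (k^{(c,c)} + k^{(-c,-c)})/2` (`abs_hrMonomialCoeffAB_neg_le`) by the `⟨εσσε⟩` block and its
  Dolan–Osborn conjugate `v^{Δ_σε} gpm` (`isConformalBlock3D_conj_gpm` + uniqueness `eq_hrBlockAB_of_lt`),
  so the majorant is `≤ const · gpm j (X,X)` — no convergence clause for `gmm` is needed.
Side conditions `Δ_σ ≠ Δ_ε`, `4Δ_σε² ≠ 1`, `Δ_σ ≠ 1` (all true on the Ising window) put the odd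
operators strictly above the unitarity bound and off the `(Δ,ℓ) = (1,0)` degeneracy of the domination.
Sources: Hogervorst–Rychkov 2013 §2–3; Dolan–Osborn 2004 §3, 2011 §2 (as typed in the tree);
Pappadopulo–Rychkov–Espin–Rattazzi 2012 §4–5 (the A1 convergence clause).
-/

namespace Summit.CriticalPhenomena.Ising3D

open Finset Set
open Literature.MathematicalPhysics.QuantumFieldTheory.ConformalBootstrap3D

/-! ### The generic step -/

/-- From block shape to `HasSummableGerms`: if every `G i = (z z̄)^{τ_i} K_i` on the square with
`τ_i ≥ 0`, and the two block-type quantities `Xₜ^{τ_i} Xₜ^{τ_i} ∑|k_i| Xₜ^{m+n}` (`t = 1,2`) are bounded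
by `Mₜ i` with `∑ |w_i| Mₜ i < ∞`, then the family `crossF s σ (G i)` has summable germs at `(x,x)`
with majorant radius `ρ < x(1-x)`. [folklore] -/
theorem hasSummableGerms_of_blockShape {ι : Type*} (w : ι → ℝ) (G : ι → ℝ → ℝ → ℝ) (s σ : ℝ)
    {x ρ : ℝ} (hx0 : 0 < x) (hx1 : x < 1) (hρ0 : 0 < ρ) (hρ : ρ < x * (1 - x))
    (k : ι → ℕ × ℕ → ℝ) (K : ι → ℝ → ℝ → ℝ) (τ : ι → ℝ)
    (hK : ∀ i, IsDoublePowerSeriesOn (k i) (K i)) (hτ : ∀ i, 0 ≤ τ i)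
    (hG : ∀ i (z zb : ℝ), z ∈ Ioo (0 : ℝ) 1 → zb ∈ Ioo (0 : ℝ) 1 →
      G i z zb = (z * zb) ^ τ i * K i z zb)
    (M₁ M₂ : ι → ℝ)
    (hM₁ : ∀ i, bgX₁ x ρ ^ τ i * bgX₁ x ρ ^ τ i *
      ∑' p : ℕ × ℕ, |k i p| * bgX₁ x ρ ^ p.1 * bgX₁ x ρ ^ p.2 ≤ M₁ i)
    (hM₂ : ∀ i, bgX₂ x ρ ^ τ i * bgX₂ x ρ ^ τ i *
      ∑' p : ℕ × ℕ, |k i p| * bgX₂ x ρ ^ p.1 * bgX₂ x ρ ^ p.2 ≤ M₂ i)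
    (hw₁ : Summable fun i => |w i| * M₁ i) (hw₂ : Summable fun i => |w i| * M₂ i) :
    HasSummableGerms w (fun i => crossF s σ (G i)) x x ρ := by
  choose T N hT hN hle using fun i =>
    crossF_germ_majorant (hK i) (hτ i) hx0 hx1 (hG i) s σ hρ0 hρ
  refine ⟨x * (1 - x), T, N, hρ.le, hT, hN, ?_⟩
  have hC₁ : 0 ≤ bgC₁ s x ρ := sq_nonneg _
  have hC₂ : 0 ≤ bgC₂ s x ρ := sq_nonneg _
  refine ((hw₁.mul_left (bgC₁ s x ρ)).add (hw₂.mul_left (|σ| * bgC₂ s x ρ))).of_nonneg_of_le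
    (fun i => mul_nonneg (abs_nonneg _) ((hN i).nonneg fun p => by positivity)) fun i => ?_
  have h1 := (hle i).trans (add_le_add (mul_le_mul_of_nonneg_left (hM₁ i) hC₁)
    (mul_le_mul_of_nonneg_left (mul_le_mul_of_nonneg_left (hM₂ i) hC₂) (abs_nonneg σ)))
  calc |w i| * N i ≤ |w i| * (bgC₁ s x ρ * M₁ i + |σ| * (bgC₂ s x ρ * M₂ i)) :=
        mul_le_mul_of_nonneg_left h1 (abs_nonneg _)
    _ = bgC₁ s x ρ * (|w i| * M₁ i) + |σ| * bgC₂ s x ρ * (|w i| * M₂ i) := by ring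

/-- The value identity for a NON-NEGATIVE array: `X^τ X^τ ∑ |k| X^{m+n} = (X·X)^τ K(X,X)`. [folklore] -/
theorem rpow_mul_tsum_abs_eq {k : ℕ × ℕ → ℝ} {K : ℝ → ℝ → ℝ} (hK : IsDoublePowerSeriesOn k K)
    (hk : ∀ p, 0 ≤ k p) (τ : ℝ) {X : ℝ} (hX0 : 0 < X) (hX1 : X < 1) :
    X ^ τ * X ^ τ * ∑' p : ℕ × ℕ, |k p| * X ^ p.1 * X ^ p.2 = (X * X) ^ τ * K X X := by
  have hXa : |X| < 1 := by rwa [abs_of_pos hX0]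
  rw [(hK X X hXa hXa).2, Real.mul_rpow hX0.le hX0.le]
  congr 1
  exact tsum_congr fun p => by rw [abs_of_nonneg (hk p)]

/-- The HR monomial array is non-negative at every admissible point (bound included). [folklore] -/
theorem hrMonomialCoeff_nonneg_of_isAdmissible {Δ : ℝ} {ℓ : ℕ} (hadm : IsAdmissible3D Δ ℓ)
    (p : ℕ × ℕ) : 0 ≤ hrMonomialCoeff Δ ℓ p := by
  unfold hrMonomialCoeff hrSlice
  split_ifs
  · exact Finset.sum_nonneg fun j _ =>
      mul_nonneg (div_nonneg (hadm.hrCoeff_nonneg _ _) (legendreLam_pos ℓ).le)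
        (legendreArrDeg_nonneg _ _ _)
  · exact le_rfl

/-! ### The `ℤ₂`-even family `gp` -/

section Families

variable {D : SigmaEpsilonData} {x ρ : ℝ}

/-- **`gp` family.** For weights with `∑ |w_i| gp_i(X₁,X₁), ∑ |w_i| gp_i(X₂,X₂) < ∞` the family
`crossF s σ (gp i)` has summable germs at `(x,x)`. [folklore] -/
theorem hasSummableGerms_gp (hD : D.SatisfiesBootstrapAxioms) (hx0 : 0 < x)
    (hx1 : x < 1) (hρ0 : 0 < ρ) (hρ : ρ < x * (1 - x)) (w : D.ιp → ℝ) (s σ : ℝ)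
    (hw₁ : Summable fun i => |w i| * D.gp i (bgX₁ x ρ) (bgX₁ x ρ))
    (hw₂ : Summable fun i => |w i| * D.gp i (bgX₂ x ρ) (bgX₂ x ρ)) :
    HasSummableGerms w (fun i => crossF s σ (D.gp i)) x x ρ := by
  have hadm := fun i => hD.sigmaAxioms.isAdmissible3D_p i
  have hX₁ := bgX₁_pos_lt hx0 hρ
  have hX₂ := bgX₂_pos_lt hx1 hρ
  have hτ : ∀ i, 0 ≤ (D.Δp i - (D.ℓp i : ℝ)) / 2 := fun i => by
    have := (hadm i).1
    have := natCast_le_unitarityBound3D (D.ℓp i)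
    linarith
  have hval : ∀ i {X : ℝ}, 0 < X → X < 1 →
      X ^ ((D.Δp i - (D.ℓp i : ℝ)) / 2) * X ^ ((D.Δp i - (D.ℓp i : ℝ)) / 2) *
        ∑' p : ℕ × ℕ, |hrMonomialCoeff (D.Δp i) (D.ℓp i) p| * X ^ p.1 * X ^ p.2 = D.gp i X X := by
    intro i X hX0 hX1
    rw [rpow_mul_tsum_abs_eq ((hadm i).isDoublePowerSeriesOn_hrSeries)
      (hrMonomialCoeff_nonneg_of_isAdmissible (hadm i)) _ hX0 hX1,
      hD.gp_eq_hrBlock i X X ⟨hX0, hX1⟩ ⟨hX0, hX1⟩, hrBlock]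
  refine hasSummableGerms_of_blockShape w _ s σ hx0 hx1 hρ0 hρ
    (fun i => hrMonomialCoeff (D.Δp i) (D.ℓp i)) (fun i => hrSeries (D.Δp i) (D.ℓp i))
    (fun i => (D.Δp i - (D.ℓp i : ℝ)) / 2) (fun i => (hadm i).isDoublePowerSeriesOn_hrSeries) hτ
    (fun i z zb hz hzb => by rw [hD.gp_eq_hrBlock i z zb hz hzb, hrBlock])
    (fun i => D.gp i (bgX₁ x ρ) (bgX₁ x ρ)) (fun i => D.gp i (bgX₂ x ρ) (bgX₂ x ρ))
    (fun i => (hval i hX₁.1 hX₁.2).le) (fun i => (hval i hX₂.1 hX₂.2).le) hw₁ hw₂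

/-- `gp i (X,X) ≥ 0` at a diagonal point of the square. [folklore] -/
theorem gp_diag_nonneg (hD : D.SatisfiesBootstrapAxioms) (i : D.ιp) {X : ℝ} (hX0 : 0 < X) (hX1 : X < 1) : 0 ≤ D.gp i X X := by
  have hadm := hD.sigmaAxioms.isAdmissible3D_p i
  rw [hD.gp_eq_hrBlock i X X ⟨hX0, hX1⟩ ⟨hX0, hX1⟩, hrBlock, hrSeries]
  exact mul_nonneg (Real.rpow_nonneg (mul_nonneg hX0.le hX0.le) _) (tsum_nonneg fun p =>
    mul_nonneg (mul_nonneg (hrMonomialCoeff_nonneg_of_isAdmissible hadm p) (pow_nonneg hX0.le _))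
      (pow_nonneg hX0.le _))

/-! ### The `⟨εσσε⟩` family `gpm` -/

/-- **`gpm` family** (`Δ_σ ≠ Δ_ε`, `4Δ_σε² ≠ 1`). [folklore] -/
theorem hasSummableGerms_gpm (hD : D.SatisfiesBootstrapAxioms) (hx0 : 0 < x)
    (hx1 : x < 1) (hρ0 : 0 < ρ) (hρ : ρ < x * (1 - x)) (hne : D.Δσ ≠ D.Δε) (hs4 : 4 * D.Δσε ^ 2 ≠ 1) (w : D.ιm → ℝ)
    (s σ : ℝ) (hw₁ : Summable fun j => |w j| * D.gpm j (bgX₁ x ρ) (bgX₁ x ρ))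
    (hw₂ : Summable fun j => |w j| * D.gpm j (bgX₂ x ρ) (bgX₂ x ρ)) :
    HasSummableGerms w (fun j => crossF s σ (D.gpm j)) x x ρ := by
  have hlt := fun j => hD.bound_lt_Δm hne hs4 j
  have hX₁ := bgX₁_pos_lt hx0 hρ
  have hX₂ := bgX₂_pos_lt hx1 hρ
  have hτ : ∀ j, 0 ≤ (D.Δm j - (D.ℓm j : ℝ)) / 2 := fun j => by
    have := (hlt j).le
    have := natCast_le_unitarityBound3D (D.ℓm j)
    linarith
  have hshape : ∀ j (z zb : ℝ), z ∈ Ioo (0 : ℝ) 1 → zb ∈ Ioo (0 : ℝ) 1 →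
      D.gpm j z zb = (z * zb) ^ ((D.Δm j - (D.ℓm j : ℝ)) / 2) *
        hrSeriesAB (D.Δσε / 2) (D.Δσε / 2) (D.Δm j) (D.ℓm j) z zb := by
    intro j z zb hz hzb
    rw [hD.gpm_eq_hrBlockAB hne hs4 j z zb hz hzb, hrBlockAB, neg_neg]
  have hval : ∀ j {X : ℝ}, 0 < X → X < 1 →
      X ^ ((D.Δm j - (D.ℓm j : ℝ)) / 2) * X ^ ((D.Δm j - (D.ℓm j : ℝ)) / 2) *
        ∑' p : ℕ × ℕ, |hrMonomialCoeffAB (D.Δσε / 2) (D.Δσε / 2) (D.Δm j) (D.ℓm j) p| *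
          X ^ p.1 * X ^ p.2 = D.gpm j X X := by
    intro j X hX0 hX1
    rw [rpow_mul_tsum_abs_eq (isDoublePowerSeriesOn_hrSeriesAB (hlt j))
      (hrMonomialCoeffAB_self_nonneg _ (hlt j)) _ hX0 hX1, hshape j X X ⟨hX0, hX1⟩ ⟨hX0, hX1⟩]
  exact hasSummableGerms_of_blockShape w _ s σ hx0 hx1 hρ0 hρ
    (fun j => hrMonomialCoeffAB (D.Δσε / 2) (D.Δσε / 2) (D.Δm j) (D.ℓm j))
    (fun j => hrSeriesAB (D.Δσε / 2) (D.Δσε / 2) (D.Δm j) (D.ℓm j))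
    (fun j => (D.Δm j - (D.ℓm j : ℝ)) / 2) (fun j => isDoublePowerSeriesOn_hrSeriesAB (hlt j)) hτ
    hshape (fun j => D.gpm j (bgX₁ x ρ) (bgX₁ x ρ)) (fun j => D.gpm j (bgX₂ x ρ) (bgX₂ x ρ))
    (fun j => (hval j hX₁.1 hX₁.2).le) (fun j => (hval j hX₂.1 hX₂.2).le) hw₁ hw₂

/-! ### The signed `⟨σεσε⟩` family `gmm` -/

/-- The domination constant `(1 + ((1-X)(1-X))^{Δ_σε})/2` of the `gmm` majorant at `(X,X)`. [folklore] -/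
noncomputable def gmmDom (D : SigmaEpsilonData) (X : ℝ) : ℝ := (1 + ((1 - X) * (1 - X)) ^ D.Δσε) / 2

/-- **Block-value domination of the signed array**: at a diagonal point `(X,X)` of the square,
`X^τ X^τ ∑ |k^{gmm}| X^{m+n} ≤ gmmDom · gpm_j(X,X)` (`Δ_σ ≠ Δ_ε`, `4Δ_σε² ≠ 1`, `Δ_σ ≠ 1`).
[folklore] -/
theorem gmm_majorant_le (hD : D.SatisfiesBootstrapAxioms) (hne : D.Δσ ≠ D.Δε) (hs4 : 4 * D.Δσε ^ 2 ≠ 1) (hσ1 : D.Δσ ≠ 1)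
    (j : D.ιm) {X : ℝ} (hX0 : 0 < X) (hX1 : X < 1) :
    X ^ ((D.Δm j - (D.ℓm j : ℝ)) / 2) * X ^ ((D.Δm j - (D.ℓm j : ℝ)) / 2) *
      ∑' p : ℕ × ℕ, |hrMonomialCoeffAB (-D.Δσε / 2) (-(-D.Δσε / 2)) (D.Δm j) (D.ℓm j) p| *
        X ^ p.1 * X ^ p.2 ≤ gmmDom D X * D.gpm j X X := by
  have hlt := hD.bound_lt_Δm hne hs4 j
  have h1 : D.ℓm j = 0 → D.Δm j ≠ 1 := by
    intro hℓ hΔ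
    have hgap := hD.2.2.2.2.1 j hℓ (by rw [hΔ]; norm_num)
    exact hσ1 (by rw [← hgap, hΔ])
  have hXa : |X| < 1 := by rwa [abs_of_pos hX0]
  have hXm : X ∈ Ioo (0 : ℝ) 1 := ⟨hX0, hX1⟩
  set τ := (D.Δm j - (D.ℓm j : ℝ)) / 2 with hτdef
  set c := -D.Δσε / 2 with hc
  -- the two non-negative reference series at (X,X)
  have hP := isDoublePowerSeriesOn_hrSeriesAB (a := c) (b := c) hlt X X hXa hXa
  have hM := isDoublePowerSeriesOn_hrSeriesAB (a := -c) (b := -c) hlt X X hXa hXa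
  have hS := isDoublePowerSeriesOn_hrSeriesAB (a := c) (b := -c) hlt X X hXa hXa
  have hP' : Summable fun p : ℕ × ℕ => hrMonomialCoeffAB c c (D.Δm j) (D.ℓm j) p * X ^ p.1 * X ^ p.2 :=
    hP.1.congr fun p => by
      rw [abs_of_nonneg (hrMonomialCoeffAB_self_nonneg _ hlt p), abs_of_pos hX0]
  have hM' : Summable fun p : ℕ × ℕ =>
      hrMonomialCoeffAB (-c) (-c) (D.Δm j) (D.ℓm j) p * X ^ p.1 * X ^ p.2 :=
    hM.1.congr fun p => by
      rw [abs_of_nonneg (hrMonomialCoeffAB_self_nonneg _ hlt p), abs_of_pos hX0]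
  have hdom : ∑' p : ℕ × ℕ, |hrMonomialCoeffAB c (-c) (D.Δm j) (D.ℓm j) p| * X ^ p.1 * X ^ p.2 ≤
      (hrSeriesAB c c (D.Δm j) (D.ℓm j) X X + hrSeriesAB (-c) (-c) (D.Δm j) (D.ℓm j) X X) / 2 := by
    rw [hP.2, hM.2, ← hP'.tsum_add hM', ← tsum_div_const]
    have hS' : Summable fun p : ℕ × ℕ =>
        |hrMonomialCoeffAB c (-c) (D.Δm j) (D.ℓm j) p| * X ^ p.1 * X ^ p.2 :=
      hS.1.congr fun p => by rw [abs_of_pos hX0]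
    refine hS'.tsum_le_tsum (fun p => ?_) ((hP'.add hM').div_const _)
    have hb := abs_hrMonomialCoeffAB_neg_le (a := c) hlt h1 p
    have hXp : 0 ≤ X ^ p.1 * X ^ p.2 := by positivity
    calc |hrMonomialCoeffAB c (-c) (D.Δm j) (D.ℓm j) p| * X ^ p.1 * X ^ p.2
        = |hrMonomialCoeffAB c (-c) (D.Δm j) (D.ℓm j) p| * (X ^ p.1 * X ^ p.2) := by ring
      _ ≤ (hrMonomialCoeffAB c c (D.Δm j) (D.ℓm j) p +
            hrMonomialCoeffAB (-c) (-c) (D.Δm j) (D.ℓm j) p) / 2 * (X ^ p.1 * X ^ p.2) :=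
          mul_le_mul_of_nonneg_right hb hXp
      _ = _ := by ring
  -- identify the two reference values with blocks at (X,X)
  have hgpm : (X * X) ^ τ * hrSeriesAB (-c) (-c) (D.Δm j) (D.ℓm j) X X = D.gpm j X X := by
    rw [hD.gpm_eq_hrBlockAB hne hs4 j X X hXm hXm, hrBlockAB, hc,
      show -(-D.Δσε / 2) = D.Δσε / 2 by ring, show -(-D.Δσε) / 2 = D.Δσε / 2 by ring]
  have hconj : (X * X) ^ τ * hrSeriesAB c c (D.Δm j) (D.ℓm j) X X =
      ((1 - X) * (1 - X)) ^ D.Δσε * D.gpm j X X := by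
    have h := (D.isConformalBlock3D_conj_gpm hD.1 j).eq_hrBlockAB_of_lt hlt X X hXm hXm
    rw [conjBlock_apply] at h
    rw [h, hrBlockAB, hc]
  have hXX : X ^ τ * X ^ τ = (X * X) ^ τ := (Real.mul_rpow hX0.le hX0.le).symm
  have hτ0 : 0 ≤ (X * X) ^ τ := Real.rpow_nonneg (mul_nonneg hX0.le hX0.le) _
  calc X ^ τ * X ^ τ * ∑' p : ℕ × ℕ, |hrMonomialCoeffAB c (-c) (D.Δm j) (D.ℓm j) p| * X ^ p.1 * X ^ p.2
      ≤ (X * X) ^ τ * ((hrSeriesAB c c (D.Δm j) (D.ℓm j) X X +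
          hrSeriesAB (-c) (-c) (D.Δm j) (D.ℓm j) X X) / 2) := by
        rw [hXX]; exact mul_le_mul_of_nonneg_left hdom hτ0
    _ = ((X * X) ^ τ * hrSeriesAB c c (D.Δm j) (D.ℓm j) X X +
          (X * X) ^ τ * hrSeriesAB (-c) (-c) (D.Δm j) (D.ℓm j) X X) / 2 := by ring
    _ = (((1 - X) * (1 - X)) ^ D.Δσε * D.gpm j X X + D.gpm j X X) / 2 := by rw [hconj, hgpm]
    _ = gmmDom D X * D.gpm j X X := by rw [gmmDom]; ring

/-- **`gmm` family** (`Δ_σ ≠ Δ_ε`, `4Δ_σε² ≠ 1`, `Δ_σ ≠ 1`): weights summable against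
`gpm j (Xₜ,Xₜ)` suffice. [folklore] -/
theorem hasSummableGerms_gmm (hD : D.SatisfiesBootstrapAxioms) (hx0 : 0 < x)
    (hx1 : x < 1) (hρ0 : 0 < ρ) (hρ : ρ < x * (1 - x)) (hne : D.Δσ ≠ D.Δε) (hs4 : 4 * D.Δσε ^ 2 ≠ 1) (hσ1 : D.Δσ ≠ 1)
    (w : D.ιm → ℝ) (s σ : ℝ) (hw₁ : Summable fun j => |w j| * D.gpm j (bgX₁ x ρ) (bgX₁ x ρ))
    (hw₂ : Summable fun j => |w j| * D.gpm j (bgX₂ x ρ) (bgX₂ x ρ)) :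
    HasSummableGerms w (fun j => crossF s σ (D.gmm j)) x x ρ := by
  have hlt := fun j => hD.bound_lt_Δm hne hs4 j
  have hX₁ := bgX₁_pos_lt hx0 hρ
  have hX₂ := bgX₂_pos_lt hx1 hρ
  have hτ : ∀ j, 0 ≤ (D.Δm j - (D.ℓm j : ℝ)) / 2 := fun j => by
    have := (hlt j).le
    have := natCast_le_unitarityBound3D (D.ℓm j)
    linarith
  have hshape : ∀ j (z zb : ℝ), z ∈ Ioo (0 : ℝ) 1 → zb ∈ Ioo (0 : ℝ) 1 →
      D.gmm j z zb = (z * zb) ^ ((D.Δm j - (D.ℓm j : ℝ)) / 2) *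
        hrSeriesAB (-D.Δσε / 2) (-(-D.Δσε / 2)) (D.Δm j) (D.ℓm j) z zb := by
    intro j z zb hz hzb
    rw [hD.gmm_eq_hrBlockAB hne hs4 j z zb hz hzb, hrBlockAB, show -(-D.Δσε / 2) = D.Δσε / 2 by ring]
  refine hasSummableGerms_of_blockShape w _ s σ hx0 hx1 hρ0 hρ
    (fun j => hrMonomialCoeffAB (-D.Δσε / 2) (-(-D.Δσε / 2)) (D.Δm j) (D.ℓm j))
    (fun j => hrSeriesAB (-D.Δσε / 2) (-(-D.Δσε / 2)) (D.Δm j) (D.ℓm j))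
    (fun j => (D.Δm j - (D.ℓm j : ℝ)) / 2) (fun j => isDoublePowerSeriesOn_hrSeriesAB (hlt j)) hτ
    hshape (fun j => gmmDom D (bgX₁ x ρ) * D.gpm j (bgX₁ x ρ) (bgX₁ x ρ))
    (fun j => gmmDom D (bgX₂ x ρ) * D.gpm j (bgX₂ x ρ) (bgX₂ x ρ))
    (fun j => gmm_majorant_le hD hne hs4 hσ1 j hX₁.1 hX₁.2)
    (fun j => gmm_majorant_le hD hne hs4 hσ1 j hX₂.1 hX₂.2) ?_ ?_
  · refine (hw₁.mul_left (gmmDom D (bgX₁ x ρ))).congr fun j => by ring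
  · refine (hw₂.mul_left (gmmDom D (bgX₂ x ρ))).congr fun j => by ring

end Families

end Summit.CriticalPhenomena.Ising3D
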